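import Summits.FinalStateConjecture.FinalStateConjecture.Theorems.EIHFluxBalanceModulatedKerrHandoffDragMatrix
import Summits.FinalStateConjecture.FinalStateConjecture.Theorems.EIHFluxBalanceModulatedKerrHandoffDragPointwise
import Summits.FinalStateConjecture.FinalStateConjecture.Theorems.EIHFluxBalanceModulatedKerrHandoffOneHoleMatching
import Summits.FinalStateConjecture.FinalStateConjecture.Theorems.EIHFluxBalanceModulatedKerrHandoffProfileAssembly

/-!
# Route EIHFluxBalance — `ModulatedKerrHandoff`: stub `stub_dragEstimates` (the Lie drag is below the weight)

Crux `stmt-FinalStateConjecture-10167`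
(`Summit.FinalStateConjecture.FinalStateConjecture.Theses.EIHFluxBalance.ModulatedKerrHandoff`), line
`overlap-modulation-second-iterate`, registered stub `stub_dragEstimates` (S6 of the lead skeleton
`Lines/overlap_modulation_second_iterate.lean`): pure `E4` calculus comparing the PLAIN modulated
multi-Kerr–Schild superposition `G = η + Σᵢ hᵢ` with the DRAGGED one `G⁺ = η + Σᵢ (hᵢ + L_{Xᵢ}hᵢ)` on the
pinned domain `U = {x⁰ > τ₀, rᵢ > r_in,i}`: (1) `G` is `C^∞` on `U`; (2) `G⁺` is `C^∞` on `U` after some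
lab time; (3) `sup_{x ∈ U, x⁰ = t} ‖Dᵐ(G⁺ − G)(x)‖ → 0`, `m ≤ 3`; (4) the same with the weight
`1 + (minᵢ ‖x̲ − ξᵢ(t)‖)^{7/4}` on the cone `{|x̲| ≤ κt}`.  These are exactly the four hypotheses of the
landed abstract transfer `PhotonRocketModulation.stub_deviationTransfer`.

Proof (files `…DragSmooth`, `…DragKernel`, `…DragMatrix`, `…DragPointwise`): `G⁺ − G = Σᵢ L_{Xᵢ}hᵢ`;
every field is `ε • 𝔉 ∘ p` for the photon line's kernel `𝔉` (`…OneHoleKernel`) with a parameter map of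
bounded positive-order size whose value lies in a compact kernel box (scale `ε = (max D₀ dᵢ)⁻¹`,
`D₀ = max 1 (2|aᵢ|)`); the frozen derivative is `ε • D𝔉(p)[(0,0,0,ε S Λ⁻¹ ·)]`; the drag matrix
`Aᵢ(t) = ½ η⁻¹ Σ_{j≠i} hⱼ(cᵢ(t))` is `O(1/t)` in `C³` by hyperbolic separation `D_{ij} ≥ v t`; Leibniz and
Faà di Bruno at the point (`…OneHoleCalculus/Leibniz`) give `‖Dᵐ(L_{Xᵢ}hᵢ)(x)‖ ≤ K ε / t`, and
`ε ≤ 1` (slabs), `(1 + d^{7/4}) ε ≤ 2 + (2t)^{3/4}` for `d ≤ 2t` (cone) finish; the holes are summed by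
`profileAssembly_tendsto_slab/cone`.  This file: the two one-hole limits (`Drag.drag_tendsto`) and the
stub.  Kerr–Schild 1965, §2–3; Dieudonné 1960, (8.12).
-/

noncomputable section

-- `Summit.<S>.<S>.…` (single-problem summit, D-0017) trips core's duplicate-namespace linter.
set_option linter.dupNamespace false

open Set Filter Function Literature.Geometry.Lorentzian
open scoped Topology ContDiff BigOperators ENNReal

namespace Summit.FinalStateConjecture.FinalStateConjecture.Theorems

namespace Drag

open OneHole Summit.FinalStateConjecture.FinalStateConjecture.Cruxes.ModulatedKerrHandoff.PhotonRocketModulation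

/-! ### Rates -/

/-- `K / t → 0`. [folklore] -/
theorem tendsto_const_div (K : ℝ) : Tendsto (fun t : ℝ ↦ K / t) atTop (𝓝 0) :=
  tendsto_const_nhds.div_atTop tendsto_id

/-- The weighted rate `K (2 + √(√((2t)³))) / t → 0` (the weight `t^{3/4}` loses against `1/t`),
squeezed under the photon line's majorant `(2 + √(√((2t)³)))(1/t + 1/t^{7/4})`. [folklore] -/
theorem tendsto_weight_div (K : ℝ) :
    Tendsto (fun t : ℝ ↦ K * ((2 + √(√((2 * t) ^ 3))) * (1 / t + 1 / (1 * t) ^ (3 / 4 + 1 : ℝ))))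
      atTop (𝓝 0) := by
  have h := (tendsto_weight_mul_rate (c := 1) (σ := 1) one_pos one_pos).const_mul K
  rwa [mul_zero] at h

/-! ### The two limits for one hole -/

section Hole

variable {N : ℕ} {M a rin : Fin N → ℝ} {Λ : Fin N → ℝ → lorentzGroup} {ξ : Fin N → ℝ → E3}
  {κ τ₀ A Cθ : ℝ}

set_option maxSynthPendingDepth 3 in
/-- **The drag of one hole tends to zero in `C³`, unweighted on whole slabs and with the weight
`1 + dᵢ^{7/4}` on the cone.** For hole `i` with core radius `r_in,i > 0`, smooth moduli, frame transfer
constant `C_θ`, tameness after `τ₀`, hyperbolic separation and centres inside the cone `κ²t`: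
`sup {‖Dᵐ(L_{Xᵢ}hᵢ)(x)‖ : x⁰ = t > τ₀, rᵢ(x) > r_in,i, m ≤ 3} → 0` and the same with the weight
`1 + ‖x̲ − ξᵢ(t)‖^{7/4}` on `{|x̲| ≤ κt}` (pointwise `≤ K ε / t` by `drag_pointwise` with the matrix size of
`exists_ck_dragMatrix`; `ε ≤ 1` on the slab, `(1 + d^{7/4}) ε ≤ 2 + (2t)^{3/4}` on the cone where
`d ≤ 2t`). [folklore] -/
theorem drag_tendsto
    (hsm : ∀ i, ContDiff ℝ ∞ (ξ i) ∧ ContDiff ℝ ∞ (fun t ↦ ((Λ i t : E4 ≃L[ℝ] E4) : E4 →L[ℝ] E4)))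
    (hC0 : 0 ≤ Cθ)
    (hCθ : ∀ j (k : ℕ) (u : ℝ),
      ‖iteratedDeriv k (fun t ↦ (((Λ j t : E4 ≃L[ℝ] E4).symm : E4 ≃L[ℝ] E4) : E4 →L[ℝ] E4)) u‖ ≤
        Cθ * ‖iteratedDeriv k (fun t ↦ ((Λ j t : E4 ≃L[ℝ] E4) : E4 →L[ℝ] E4)) u‖)
    (hcone : 0 < κ ∧ κ < 1 ∧ ∀ i, ∀ᶠ t in atTop, ‖ξ i t‖ ≤ κ ^ 2 * t)
    (hhyp : ∀ i j, i ≠ j → ∃ v : ℝ, 0 < v ∧ ∀ᶠ t in atTop, v * t ≤ ‖ξ i t - ξ j t‖)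
    (htame : ∀ i t, τ₀ ≤ t →
      (∀ k, k ≤ 4 → ‖iteratedDeriv k (fun s ↦ ((Λ i s : E4 ≃L[ℝ] E4) : E4 →L[ℝ] E4)) t‖ ≤ A) ∧
        ∀ k, 1 ≤ k → k ≤ 4 → ‖iteratedDeriv k (ξ i) t‖ ≤ A)
    (i : Fin N) (hrin : 0 < rin i) :
    Tendsto (fun t : ℝ ↦ ⨆ x ∈ {x : E4 | x 0 = t ∧ τ₀ < x 0 ∧ rin i < Kerr.radius (a i) (poincareInv (Λ i (x 0)) (E4.ofTimeSpace (x 0) (ξ i (x 0))) x)},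
      ⨆ (m : ℕ) (_ : m ≤ 3), ‖iteratedFDeriv ℝ m (fun x ↦ fderiv ℝ (fun z ↦ boostedKerrBilin (Λ i (x 0)) (E4.ofTimeSpace (x 0) (ξ i (x 0))) (M i) (a i) z - Minkowski.bilin) x (((2⁻¹ : ℝ) • ((Minkowski.bilin : E4 →L[ℝ] E4 →L[ℝ] ℝ).inverse.comp (∑ j ∈ Finset.univ.erase i, (boostedKerrBilin (Λ j (x 0)) (E4.ofTimeSpace (x 0) (ξ j (x 0))) (M j) (a j) (E4.ofTimeSpace (x 0) (ξ i (x 0))) - Minkowski.bilin)))) (x - (E4.ofTimeSpace (x 0) (ξ i (x 0))))) + (boostedKerrBilin (Λ i (x 0)) (E4.ofTimeSpace (x 0) (ξ i (x 0))) (M i) (a i) x - Minkowski.bilin).comp ((2⁻¹ : ℝ) • ((Minkowski.bilin : E4 →L[ℝ] E4 →L[ℝ] ℝ).inverse.comp (∑ j ∈ Finset.univ.erase i, (boostedKerrBilin (Λ j (x 0)) (E4.ofTimeSpace (x 0) (ξ j (x 0))) (M j) (a j) (E4.ofTimeSpace (x 0) (ξ i (x 0))) - Minkowski.bilin)))) +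 (ContinuousLinearMap.precomp ℝ ((2⁻¹ : ℝ) • ((Minkowski.bilin : E4 →L[ℝ] E4 →L[ℝ] ℝ).inverse.comp (∑ j ∈ Finset.univ.erase i, (boostedKerrBilin (Λ j (x 0)) (E4.ofTimeSpace (x 0) (ξ j (x 0))) (M j) (a j) (E4.ofTimeSpace (x 0) (ξ i (x 0))) - Minkowski.bilin))))).comp (boostedKerrBilin (Λ i (x 0)) (E4.ofTimeSpace (x 0) (ξ i (x 0))) (M i) (a i) x - Minkowski.bilin)) x‖ₑ) atTop (𝓝 0) ∧
    Tendsto (fun t : ℝ ↦ ⨆ x ∈ {x : E4 | x 0 = t ∧ E4.spatialNorm x ≤ κ * t ∧ τ₀ < x 0 ∧ rin i < Kerr.radius (a i) (poincareInv (Λ i (x 0)) (E4.ofTimeSpace (x 0) (ξ i (x 0))) x)},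
      ⨆ (m : ℕ) (_ : m ≤ 3), ENNReal.ofReal (1 + √(√(‖E4.spatial x - ξ i t‖ ^ 7))) *
        ‖iteratedFDeriv ℝ m (fun x ↦ fderiv ℝ (fun z ↦ boostedKerrBilin (Λ i (x 0)) (E4.ofTimeSpace (x 0) (ξ i (x 0))) (M i) (a i) z - Minkowski.bilin) x (((2⁻¹ : ℝ) • ((Minkowski.bilin : E4 →L[ℝ] E4 →L[ℝ] ℝ).inverse.comp (∑ j ∈ Finset.univ.erase i, (boostedKerrBilin (Λ j (x 0)) (E4.ofTimeSpace (x 0) (ξ j (x 0))) (M j) (a j) (E4.ofTimeSpace (x 0) (ξ i (x 0))) - Minkowski.bilin)))) (x - (E4.ofTimeSpace (x 0) (ξ i (x 0))))) + (boostedKerrBilin (Λ i (x 0)) (E4.ofTimeSpace (x 0) (ξ i (x 0))) (M i) (a i) x - Minkowski.bilin).comp ((2⁻¹ : ℝ) • ((Minkowski.bilin : E4 →L[ℝ] E4 →L[ℝ] ℝ).inverse.comp (∑ j ∈ Finset.univ.erase i, (boostedKerrBilin (Λ j (x 0)) (E4.ofTimeSpace (x 0) (ξ j (x 0))) (M j)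 (a j) (E4.ofTimeSpace (x 0) (ξ i (x 0))) - Minkowski.bilin)))) + (ContinuousLinearMap.precomp ℝ ((2⁻¹ : ℝ) • ((Minkowski.bilin : E4 →L[ℝ] E4 →L[ℝ] ℝ).inverse.comp (∑ j ∈ Finset.univ.erase i, (boostedKerrBilin (Λ j (x 0)) (E4.ofTimeSpace (x 0) (ξ j (x 0))) (M j) (a j) (E4.ofTimeSpace (x 0) (ξ i (x 0))) - Minkowski.bilin))))).comp (boostedKerrBilin (Λ i (x 0)) (E4.ofTimeSpace (x 0) (ξ i (x 0))) (M i) (a i) x - Minkowski.bilin)) x‖ₑ) atTop (𝓝 0) := by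
  obtain ⟨KA, TA, hKA0, hτ, h1, hAm⟩ := exists_ck_dragMatrix (M := M) (a := a) (fun j ↦ (hsm j).2)
    (fun j ↦ (hsm j).1) hC0 hCθ htame hhyp i
  obtain ⟨K, hK0, hpt⟩ := drag_pointwise (M i) (a i) (hsm i).2 (hsm i).1 hC0 (hCθ i) (htame i) hKA0
    ⟨hτ, h1⟩ hAm hrin
  obtain ⟨T₁, hT₁⟩ := eventually_atTop.mp (hcone.2.2 i)
  constructor
  · refine tendsto_zero_of_le_ofReal (tendsto_const_div K) ?_
    filter_upwards [eventually_ge_atTop TA] with t ht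
    refine iSup₂_enorm_le_ofReal fun x hx m hm ↦ ?_
    obtain ⟨hxt, -, hxr⟩ := hx
    have hxT : TA ≤ x 0 := by rw [hxt]; exact ht
    have ht0 : 0 < x 0 := one_pos.trans_le (h1.trans hxT)
    obtain ⟨-, hε1, -, -⟩ := scale_bounds (a i) ‖E4.spatial x - ξ i (x 0)‖
    refine (hpt x hxT hxr m hm).trans ?_
    rw [← hxt]
    calc K * (max (max 1 (2 * |a i|)) ‖E4.spatial x - ξ i (x 0)‖)⁻¹ / x 0 ≤ K * 1 / x 0 :=
          div_le_div_of_nonneg_right (mul_le_mul_of_nonneg_left hε1 hK0) ht0.le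
      _ = K / x 0 := by rw [mul_one]
  · refine tendsto_zero_of_le_ofReal (tendsto_weight_div K) ?_
    filter_upwards [eventually_ge_atTop TA, eventually_ge_atTop T₁] with t ht ht'
    refine iSup₂_weight_enorm_le_ofReal (fun x ↦ by positivity) fun x hx m hm ↦ ?_
    obtain ⟨hxt, hxκ, -, hxr⟩ := hx
    have hxT : TA ≤ x 0 := by rw [hxt]; exact ht
    have ht1 : 1 ≤ x 0 := h1.trans hxT
    have ht0 : 0 < x 0 := one_pos.trans_le ht1
    obtain ⟨hε0, -, -, hεm⟩ := scale_bounds (a i) ‖E4.spatial x - ξ i (x 0)‖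
    have hξt : ‖ξ i (x 0)‖ ≤ κ ^ 2 * x 0 := hT₁ _ (by rw [hxt]; exact ht')
    have hd2 : ‖E4.spatial x - ξ i (x 0)‖ ≤ 2 * x 0 :=
      dist_le_two_mul_of_cone hcone.1 hcone.2.1 (by rw [hxt]; exact hxκ) hξt ht0.le
    have hw := weight_mul_scale_le (norm_nonneg (E4.spatial x - ξ i (x 0))) hd2
    have hw0 : 0 ≤ 1 + √(√(‖E4.spatial x - ξ i (x 0)‖ ^ 7)) := by positivity
    have h := hpt x hxT hxr m hm
    rw [← hxt]
    refine (mul_le_mul_of_nonneg_left h hw0).trans ?_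
    have hrate : 1 / x 0 ≤ 1 / x 0 + 1 / (1 * x 0) ^ (3 / 4 + 1 : ℝ) :=
      le_add_of_nonneg_right (by positivity)
    calc (1 + √(√(‖E4.spatial x - ξ i (x 0)‖ ^ 7))) *
        (K * (max (max 1 (2 * |a i|)) ‖E4.spatial x - ξ i (x 0)‖)⁻¹ / x 0)
        = K * ((1 + √(√(‖E4.spatial x - ξ i (x 0)‖ ^ 7))) *
            (max (max 1 (2 * |a i|)) ‖E4.spatial x - ξ i (x 0)‖)⁻¹) * (1 / x 0) := by ring
      _ ≤ K * ((1 + √(√(‖E4.spatial x - ξ i (x 0)‖ ^ 7))) * (max 1 ‖E4.spatial x - ξ i (x 0)‖)⁻¹) *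
            (1 / x 0) := by gcongr
      _ ≤ K * (2 + √(√((2 * x 0) ^ 3))) * (1 / x 0) := by gcongr
      _ ≤ K * (2 + √(√((2 * x 0) ^ 3))) * (1 / x 0 + 1 / (1 * x 0) ^ (3 / 4 + 1 : ℝ)) := by gcongr
      _ = K * ((2 + √(√((2 * x 0) ^ 3))) * (1 / x 0 + 1 / (1 * x 0) ^ (3 / 4 + 1 : ℝ))) := by ring

end Hole

end Drag

end Summit.FinalStateConjecture.FinalStateConjecture.Theorems

namespace Summit.FinalStateConjecture.FinalStateConjecture.Cruxes.ModulatedKerrHandoff.OverlapModulationSecondIterate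

open scoped Manifold ContDiff Topology BigOperators ENNReal
open Set Function Filter TopologicalSpace Literature.Geometry.Lorentzian
open Summit.FinalStateConjecture.FinalStateConjecture.Theorems
open Summit.FinalStateConjecture.FinalStateConjecture.Cruxes.ModulatedKerrHandoff.PhotonRocketModulation

set_option maxSynthPendingDepth 3 in
/-- **S6 · `stub_dragEstimates`** (registered stub of the line `overlap-modulation-second-iterate`, crux
`EIHFluxBalance.ModulatedKerrHandoff`, item `stmt-FinalStateConjecture-10167`): for sub-extremal labels
with cores `r_in,i ∈ (r₋, r₊)`, smooth moduli, centres in the cone, HYPERBOLIC pairwise separation and TAME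
moduli after `τ₀`, on the pinned domain `U = {x⁰ > τ₀, rᵢ > r_in,i}`: (1) the plain modulated
superposition `G` is `C^∞` on `U`; (2) the dragged superposition `G⁺` is `C^∞` on `U` after some lab
time; (3) `sup_{x ∈ U, x⁰ = t} ‖Dᵐ(G⁺ − G)(x)‖ → 0` (`m ≤ 3`); (4) the same with the weight
`1 + (minᵢ dᵢ)^{7/4}` on `{|x̲| ≤ κt}`.  Proof: `G⁺ − G = Σᵢ L_{Xᵢ}hᵢ` (`Drag.sum_add_sub_sum_eq`);
smoothness by `…DragSmooth`; each drag term is `≤ K ε/t` in `C³` (`Drag.drag_pointwise`, fed by the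
matrix size `Drag.exists_ck_dragMatrix`), whence the one-hole limits `Drag.drag_tendsto`, assembled
over the holes by the photon line's `profileAssembly_tendsto_slab/cone`. Kerr–Schild 1965, §2–3.
[folklore] -/
theorem stub_dragEstimates :
    ∀ (N : ℕ) (M a rin : Fin N → ℝ) (Λ : Fin N → ℝ → lorentzGroup) (ξ : Fin N → ℝ → E3) (γ κ τ₀ A : ℝ) (U : Opens E4),
      (∀ i, Kerr.IsSubextremal (M i) (a i) ∧ Kerr.rMinus (M i) (a i) < rin i ∧ rin i < Kerr.rPlus (M i) (a i)) →
      (∀ i t, |((Λ i t : E4 ≃L[ℝ] E4) (E4.basisVector 0)) 0| ≤ γ) →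
      (∀ i, ContDiff ℝ ((⊤ : ℕ∞) : WithTop ℕ∞) (ξ i) ∧
        ContDiff ℝ ((⊤ : ℕ∞) : WithTop ℕ∞) (fun t ↦ ((Λ i t : E4 ≃L[ℝ] E4) : E4 →L[ℝ] E4))) →
      (0 < κ ∧ κ < 1 ∧ ∀ i, ∀ᶠ t in atTop, ‖ξ i t‖ ≤ κ ^ 2 * t) →
      (∀ i j, i ≠ j → ∃ v : ℝ, 0 < v ∧ ∀ᶠ t in atTop, v * t ≤ ‖ξ i t - ξ j t‖) →
      (∀ i t, τ₀ ≤ t → (∀ k, k ≤ 4 → ‖iteratedDeriv k (fun s ↦ ((Λ i s : E4 ≃L[ℝ] E4) : E4 →L[ℝ] E4)) t‖ ≤ A) ∧ ∀ k, 1 ≤ k → k ≤ 4 → ‖iteratedDeriv k (ξ i) t‖ ≤ A) →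
      (U : Set E4) = {x : E4 | τ₀ < x 0 ∧ ∀ i, rin i < Kerr.radius (a i) (poincareInv (Λ i (x 0)) (E4.ofTimeSpace (x 0) (ξ i (x 0))) x)} →
      (∀ x : U, ContDiffAt ℝ ((⊤ : ℕ∞) : WithTop ℕ∞) (fun x ↦ Minkowski.bilin + ∑ i, (boostedKerrBilin (Λ i (x 0)) (E4.ofTimeSpace (x 0) (ξ i (x 0))) (M i) (a i) x - Minkowski.bilin)) x.1) ∧
      (∃ T : ℝ, ∀ x : U, T < x.1 0 → ContDiffAt ℝ ((⊤ : ℕ∞) : WithTop ℕ∞) (fun x ↦ Minkowski.bilin + ∑ i, ((boostedKerrBilin (Λ i (x 0)) (E4.ofTimeSpace (x 0) (ξ i (x 0))) (M i) (a i) x - Minkowski.bilin) + (fderiv ℝ (fun z ↦ boostedKerrBilin (Λ i (x 0)) (E4.ofTimeSpace (x 0) (ξ i (x 0))) (M i) (a i) z - Minkowski.bilin) x (((2⁻¹ : ℝ) • ((Minkowski.bilin : E4 →L[ℝ] E4 →L[ℝ] ℝ).inverse.comp (∑ j ∈ Finset.univ.erase i, (boostedKerrBilin (Λ j (x 0)) (E4.ofTimeSpace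 (x 0) (ξ j (x 0))) (M j) (a j) (E4.ofTimeSpace (x 0) (ξ i (x 0))) - Minkowski.bilin)))) (x - (E4.ofTimeSpace (x 0) (ξ i (x 0))))) + (boostedKerrBilin (Λ i (x 0)) (E4.ofTimeSpace (x 0) (ξ i (x 0))) (M i) (a i) x - Minkowski.bilin).comp ((2⁻¹ : ℝ) • ((Minkowski.bilin : E4 →L[ℝ] E4 →L[ℝ] ℝ).inverse.comp (∑ j ∈ Finset.univ.erase i, (boostedKerrBilin (Λ j (x 0)) (E4.ofTimeSpace (x 0) (ξ j (x 0))) (M j) (a j) (E4.ofTimeSpace (x 0) (ξ i (x 0))) - Minkowski.bilin)))) + (ContinuousLinearMap.precomp ℝ ((2⁻¹ : ℝ) • ((Minkowski.bilin : E4 →L[ℝ] E4 →L[ℝ] ℝ).inverse.comp (∑ j ∈ Finset.univ.erase i, (boostedKerrBilin (Λ j (x 0)) (E4.ofTimeSpace (x 0) (ξ j (x 0))) (M j) (a j) (E4.ofTimeSpace (x 0) (ξ i (x 0))) - Minkowski.bilin))))).comp (boostedKerrBilin (Λ i (x 0)) (E4.ofTimeSpace (x 0) (ξ i (x 0))) (M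 i) (a i) x - Minkowski.bilin)))) x.1) ∧
      Tendsto (fun t : ℝ ↦ ⨆ x ∈ {x : U | x.1 0 = t}, ⨆ (m : ℕ) (_ : m ≤ 3),
        ‖iteratedFDeriv ℝ m (fun y ↦ (Minkowski.bilin + ∑ i, ((boostedKerrBilin (Λ i (y 0)) (E4.ofTimeSpace (y 0) (ξ i (y 0))) (M i) (a i) y - Minkowski.bilin) + (fderiv ℝ (fun z ↦ boostedKerrBilin (Λ i (y 0)) (E4.ofTimeSpace (y 0) (ξ i (y 0))) (M i) (a i) z - Minkowski.bilin) y (((2⁻¹ : ℝ) • ((Minkowski.bilin : E4 →L[ℝ] E4 →L[ℝ] ℝ).inverse.comp (∑ j ∈ Finset.univ.erase i, (boostedKerrBilin (Λ j (y 0)) (E4.ofTimeSpace (y 0) (ξ j (y 0))) (M j) (a j) (E4.ofTimeSpace (y 0) (ξ i (y 0))) - Minkowski.bilin)))) (y - (E4.ofTimeSpace (y 0) (ξ i (y 0))))) + (boostedKerrBilin (Λ i (y 0)) (E4.ofTimeSpace (y 0) (ξ i (y 0))) (M i) (a i) y - Minkowski.bilin).comp ((2⁻¹ : ℝ) • ((Minkowski.bilin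 : E4 →L[ℝ] E4 →L[ℝ] ℝ).inverse.comp (∑ j ∈ Finset.univ.erase i, (boostedKerrBilin (Λ j (y 0)) (E4.ofTimeSpace (y 0) (ξ j (y 0))) (M j) (a j) (E4.ofTimeSpace (y 0) (ξ i (y 0))) - Minkowski.bilin)))) + (ContinuousLinearMap.precomp ℝ ((2⁻¹ : ℝ) • ((Minkowski.bilin : E4 →L[ℝ] E4 →L[ℝ] ℝ).inverse.comp (∑ j ∈ Finset.univ.erase i, (boostedKerrBilin (Λ j (y 0)) (E4.ofTimeSpace (y 0) (ξ j (y 0))) (M j) (a j) (E4.ofTimeSpace (y 0) (ξ i (y 0))) - Minkowski.bilin))))).comp (boostedKerrBilin (Λ i (y 0)) (E4.ofTimeSpace (y 0) (ξ i (y 0))) (M i) (a i) y - Minkowski.bilin)))) - (Minkowski.bilin + ∑ i, (boostedKerrBilin (Λ i (y 0)) (E4.ofTimeSpace (y 0) (ξ i (y 0))) (M i) (a i) y - Minkowski.bilin))) x.1‖ₑ) atTop (𝓝 0) ∧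
      Tendsto (fun t : ℝ ↦ ⨆ x ∈ {x : U | x.1 0 = t ∧ E4.spatialNorm x.1 ≤ κ * t}, ⨆ (m : ℕ) (_ : m ≤ 3),
        ENNReal.ofReal (1 + √(√((⨅ i, ‖E4.spatial x.1 - ξ i t‖) ^ 7))) * ‖iteratedFDeriv ℝ m (fun y ↦ (Minkowski.bilin + ∑ i, ((boostedKerrBilin (Λ i (y 0)) (E4.ofTimeSpace (y 0) (ξ i (y 0))) (M i) (a i) y - Minkowski.bilin) + (fderiv ℝ (fun z ↦ boostedKerrBilin (Λ i (y 0)) (E4.ofTimeSpace (y 0) (ξ i (y 0))) (M i) (a i) z - Minkowski.bilin) y (((2⁻¹ : ℝ) • ((Minkowski.bilin : E4 →L[ℝ] E4 →L[ℝ] ℝ).inverse.comp (∑ j ∈ Finset.univ.erase i, (boostedKerrBilin (Λ j (y 0)) (E4.ofTimeSpace (y 0) (ξ j (y 0))) (M j) (a j) (E4.ofTimeSpace (y 0) (ξ i (y 0))) - Minkowski.bilin)))) (y - (E4.ofTimeSpace (y 0) (ξ i (y 0))))) + (boostedKerrBilin (Λ i (y 0)) (E4.ofTimeSpace (y 0)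 (ξ i (y 0))) (M i) (a i) y - Minkowski.bilin).comp ((2⁻¹ : ℝ) • ((Minkowski.bilin : E4 →L[ℝ] E4 →L[ℝ] ℝ).inverse.comp (∑ j ∈ Finset.univ.erase i, (boostedKerrBilin (Λ j (y 0)) (E4.ofTimeSpace (y 0) (ξ j (y 0))) (M j) (a j) (E4.ofTimeSpace (y 0) (ξ i (y 0))) - Minkowski.bilin)))) + (ContinuousLinearMap.precomp ℝ ((2⁻¹ : ℝ) • ((Minkowski.bilin : E4 →L[ℝ] E4 →L[ℝ] ℝ).inverse.comp (∑ j ∈ Finset.univ.erase i, (boostedKerrBilin (Λ j (y 0)) (E4.ofTimeSpace (y 0) (ξ j (y 0))) (M j) (a j) (E4.ofTimeSpace (y 0) (ξ i (y 0))) - Minkowski.bilin))))).comp (boostedKerrBilin (Λ i (y 0)) (E4.ofTimeSpace (y 0) (ξ i (y 0))) (M i) (a i) y - Minkowski.bilin)))) - (Minkowski.bilin + ∑ i, (boostedKerrBilin (Λ i (y 0)) (E4.ofTimeSpace (y 0) (ξ i (y 0))) (M i) (a i) y - Minkowski.bilin))) x.1‖ₑ) atTop (𝓝 0) := by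
  intro N M a rin Λ ξ γ κ τ₀ A U hsub hγ hsm hcone hhyp htame hU
  obtain ⟨Cθ, hC0, hCθ⟩ := OneHole.exists_norm_iteratedDeriv_theta_le
  have hCθ' : ∀ j (k : ℕ) (u : ℝ),
      ‖iteratedDeriv k (fun t ↦ (((Λ j t : E4 ≃L[ℝ] E4).symm : E4 ≃L[ℝ] E4) : E4 →L[ℝ] E4)) u‖ ≤
        Cθ * ‖iteratedDeriv k (fun t ↦ ((Λ j t : E4 ≃L[ℝ] E4) : E4 →L[ℝ] E4)) u‖ :=
    fun j ↦ hCθ (Λ j) (hsm j).2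
  have hrin : ∀ i, 0 < rin i := fun i ↦ OneHole.rin_pos (hsub i)
  have hmem : ∀ x : U, τ₀ < x.1 0 ∧
      ∀ i, rin i < Kerr.radius (a i) (poincareInv (Λ i (x.1 0)) (E4.ofTimeSpace (x.1 0) (ξ i (x.1 0))) x.1) :=
    fun x ↦ by
      have hx : x.1 ∈ (U : Set E4) := x.2
      rw [hU] at hx
      exact hx
  obtain ⟨T, hT⟩ := Drag.exists_forall_abs_lt_dist a hhyp
  have hg : ∀ i (x : U), T < x.1 0 → ∀ m : ℕ, m ≤ 3 → ContDiffAt ℝ m (fun x ↦ fderiv ℝ (fun z ↦ boostedKerrBilin (Λ i (x 0)) (E4.ofTimeSpace (x 0) (ξ i (x 0))) (M i) (a i) z - Minkowski.bilin) x (((2⁻¹ : ℝ) • ((Minkowski.bilin : E4 →L[ℝ] E4 →L[ℝ] ℝ).inverse.comp (∑ j ∈ Finset.univ.erase i, (boostedKerrBilin (Λ j (x 0)) (E4.ofTimeSpace (x 0) (ξ j (x 0))) (M j) (a j) (E4.ofTimeSpace (x 0) (ξ i (x 0))) - Minkowski.bilin)))) (x - (E4.ofTimeSpace (x 0) (ξ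 i (x 0))))) + (boostedKerrBilin (Λ i (x 0)) (E4.ofTimeSpace (x 0) (ξ i (x 0))) (M i) (a i) x - Minkowski.bilin).comp ((2⁻¹ : ℝ) • ((Minkowski.bilin : E4 →L[ℝ] E4 →L[ℝ] ℝ).inverse.comp (∑ j ∈ Finset.univ.erase i, (boostedKerrBilin (Λ j (x 0)) (E4.ofTimeSpace (x 0) (ξ j (x 0))) (M j) (a j) (E4.ofTimeSpace (x 0) (ξ i (x 0))) - Minkowski.bilin)))) + (ContinuousLinearMap.precomp ℝ ((2⁻¹ : ℝ) • ((Minkowski.bilin : E4 →L[ℝ] E4 →L[ℝ] ℝ).inverse.comp (∑ j ∈ Finset.univ.erase i, (boostedKerrBilin (Λ j (x 0)) (E4.ofTimeSpace (x 0) (ξ j (x 0))) (M j) (a j) (E4.ofTimeSpace (x 0) (ξ i (x 0))) - Minkowski.bilin))))).comp (boostedKerrBilin (Λ i (x 0)) (E4.ofTimeSpace (x 0) (ξ i (x 0))) (M i) (a i) x - Minkowski.bilin)) x.1 :=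
    fun i x hx m _ ↦ (Drag.contDiffAt_drag (M := M) (fun j ↦ (hsm j).2) (fun j ↦ (hsm j).1)
      (fun j hj ↦ hT _ hx i j (Ne.symm hj)) ((hrin i).trans ((hmem x).2 i))).of_le (by exact_mod_cast le_top)
  have hlim := fun i ↦ Drag.drag_tendsto (M := M) (a := a) hsm hC0 hCθ' hcone hhyp htame i (hrin i)
  refine ⟨fun x ↦ ?_, ⟨T, fun x hx ↦ contDiffAt_const.add (ContDiffAt.sum fun i _ ↦ ?_)⟩, ?_, ?_⟩
  · exact contDiffAt_ansatzBilin' N M a Λ ξ (fun i ↦ (hsm i).2) (fun i ↦ (hsm i).1) x.1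
      (fun i ↦ (hrin i).trans ((hmem x).2 i))
  · exact Drag.contDiffAt_dragged (M := M) (fun j ↦ (hsm j).2) (fun j ↦ (hsm j).1)
      (fun j hj ↦ hT _ hx i j (Ne.symm hj)) ((hrin i).trans ((hmem x).2 i))
  · rw [Drag.sum_add_sub_sum_eq (fun i x ↦ (boostedKerrBilin (Λ i (x 0)) (E4.ofTimeSpace (x 0) (ξ i (x 0))) (M i) (a i) x - Minkowski.bilin)) (fun i x ↦ fderiv ℝ (fun z ↦ boostedKerrBilin (Λ i (x 0)) (E4.ofTimeSpace (x 0) (ξ i (x 0))) (M i) (a i) z - Minkowski.bilin) x (((2⁻¹ : ℝ) • ((Minkowski.bilin : E4 →L[ℝ] E4 →L[ℝ] ℝ).inverse.comp (∑ j ∈ Finset.univ.erase i, (boostedKerrBilin (Λ j (x 0)) (E4.ofTimeSpace (x 0) (ξ j (x 0))) (M j) (a j) (E4.ofTimeSpace (x 0) (ξ i (x 0))) - Minkowski.bilin)))) (x - (E4.ofTimeSpace (x 0) (ξ i (x 0))))) + (boostedKerrBilin (Λ i (x 0)) (E4.ofTimeSpace (x 0) (ξ i (x 0))) (M i) (a i)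 x - Minkowski.bilin).comp ((2⁻¹ : ℝ) • ((Minkowski.bilin : E4 →L[ℝ] E4 →L[ℝ] ℝ).inverse.comp (∑ j ∈ Finset.univ.erase i, (boostedKerrBilin (Λ j (x 0)) (E4.ofTimeSpace (x 0) (ξ j (x 0))) (M j) (a j) (E4.ofTimeSpace (x 0) (ξ i (x 0))) - Minkowski.bilin)))) + (ContinuousLinearMap.precomp ℝ ((2⁻¹ : ℝ) • ((Minkowski.bilin : E4 →L[ℝ] E4 →L[ℝ] ℝ).inverse.comp (∑ j ∈ Finset.univ.erase i, (boostedKerrBilin (Λ j (x 0)) (E4.ofTimeSpace (x 0) (ξ j (x 0))) (M j) (a j) (E4.ofTimeSpace (x 0) (ξ i (x 0))) - Minkowski.bilin))))).comp (boostedKerrBilin (Λ i (x 0)) (E4.ofTimeSpace (x 0) (ξ i (x 0))) (M i) (a i) x - Minkowski.bilin)) Minkowski.bilin]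
    exact profileAssembly_tendsto_slab (fun i x ↦ fderiv ℝ (fun z ↦ boostedKerrBilin (Λ i (x 0)) (E4.ofTimeSpace (x 0) (ξ i (x 0))) (M i) (a i) z - Minkowski.bilin) x (((2⁻¹ : ℝ) • ((Minkowski.bilin : E4 →L[ℝ] E4 →L[ℝ] ℝ).inverse.comp (∑ j ∈ Finset.univ.erase i, (boostedKerrBilin (Λ j (x 0)) (E4.ofTimeSpace (x 0) (ξ j (x 0))) (M j) (a j) (E4.ofTimeSpace (x 0) (ξ i (x 0))) - Minkowski.bilin)))) (x - (E4.ofTimeSpace (x 0) (ξ i (x 0))))) + (boostedKerrBilin (Λ i (x 0)) (E4.ofTimeSpace (x 0) (ξ i (x 0))) (M i) (a i) x - Minkowski.bilin).comp ((2⁻¹ : ℝ) • ((Minkowski.bilin : E4 →L[ℝ] E4 →L[ℝ] ℝ).inverse.comp (∑ j ∈ Finset.univ.erase i, (boostedKerrBilin (Λ j (x 0)) (E4.ofTimeSpace (x 0) (ξ j (x 0))) (M j) (a j) (E4.ofTimeSpace (x 0) (ξ i (x 0))) - Minkowski.bilin)))) + (ContinuousLinearMap.precomp ℝ ((2⁻¹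 : ℝ) • ((Minkowski.bilin : E4 →L[ℝ] E4 →L[ℝ] ℝ).inverse.comp (∑ j ∈ Finset.univ.erase i, (boostedKerrBilin (Λ j (x 0)) (E4.ofTimeSpace (x 0) (ξ j (x 0))) (M j) (a j) (E4.ofTimeSpace (x 0) (ξ i (x 0))) - Minkowski.bilin))))).comp (boostedKerrBilin (Λ i (x 0)) (E4.ofTimeSpace (x 0) (ξ i (x 0))) (M i) (a i) x - Minkowski.bilin)) (fun i x ↦ rin i < Kerr.radius (a i) (poincareInv (Λ i (x 0)) (E4.ofTimeSpace (x 0) (ξ i (x 0))) x)) τ₀ T U hmem hg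
      (fun i ↦ (hlim i).1)
  · rw [Drag.sum_add_sub_sum_eq (fun i x ↦ (boostedKerrBilin (Λ i (x 0)) (E4.ofTimeSpace (x 0) (ξ i (x 0))) (M i) (a i) x - Minkowski.bilin)) (fun i x ↦ fderiv ℝ (fun z ↦ boostedKerrBilin (Λ i (x 0)) (E4.ofTimeSpace (x 0) (ξ i (x 0))) (M i) (a i) z - Minkowski.bilin) x (((2⁻¹ : ℝ) • ((Minkowski.bilin : E4 →L[ℝ] E4 →L[ℝ] ℝ).inverse.comp (∑ j ∈ Finset.univ.erase i, (boostedKerrBilin (Λ j (x 0)) (E4.ofTimeSpace (x 0) (ξ j (x 0))) (M j) (a j) (E4.ofTimeSpace (x 0) (ξ i (x 0))) - Minkowski.bilin)))) (x - (E4.ofTimeSpace (x 0) (ξ i (x 0))))) + (boostedKerrBilin (Λ i (x 0)) (E4.ofTimeSpace (x 0) (ξ i (x 0))) (M i) (a i) x - Minkowski.bilin).comp ((2⁻¹ : ℝ) • ((Minkowski.bilin : E4 →L[ℝ] E4 →L[ℝ] ℝ).inverse.comp (∑ j ∈ Finset.univ.erase i, (boostedKerrBilin (Λ j (x 0)) (E4.ofTimeSpace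 (x 0) (ξ j (x 0))) (M j) (a j) (E4.ofTimeSpace (x 0) (ξ i (x 0))) - Minkowski.bilin)))) + (ContinuousLinearMap.precomp ℝ ((2⁻¹ : ℝ) • ((Minkowski.bilin : E4 →L[ℝ] E4 →L[ℝ] ℝ).inverse.comp (∑ j ∈ Finset.univ.erase i, (boostedKerrBilin (Λ j (x 0)) (E4.ofTimeSpace (x 0) (ξ j (x 0))) (M j) (a j) (E4.ofTimeSpace (x 0) (ξ i (x 0))) - Minkowski.bilin))))).comp (boostedKerrBilin (Λ i (x 0)) (E4.ofTimeSpace (x 0) (ξ i (x 0))) (M i) (a i) x - Minkowski.bilin)) Minkowski.bilin]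
    exact profileAssembly_tendsto_cone (fun i x ↦ fderiv ℝ (fun z ↦ boostedKerrBilin (Λ i (x 0)) (E4.ofTimeSpace (x 0) (ξ i (x 0))) (M i) (a i) z - Minkowski.bilin) x (((2⁻¹ : ℝ) • ((Minkowski.bilin : E4 →L[ℝ] E4 →L[ℝ] ℝ).inverse.comp (∑ j ∈ Finset.univ.erase i, (boostedKerrBilin (Λ j (x 0)) (E4.ofTimeSpace (x 0) (ξ j (x 0))) (M j) (a j) (E4.ofTimeSpace (x 0) (ξ i (x 0))) - Minkowski.bilin)))) (x - (E4.ofTimeSpace (x 0) (ξ i (x 0))))) + (boostedKerrBilin (Λ i (x 0)) (E4.ofTimeSpace (x 0) (ξ i (x 0))) (M i) (a i) x - Minkowski.bilin).comp ((2⁻¹ : ℝ) • ((Minkowski.bilin : E4 →L[ℝ] E4 →L[ℝ] ℝ).inverse.comp (∑ j ∈ Finset.univ.erase i, (boostedKerrBilin (Λ j (x 0)) (E4.ofTimeSpace (x 0) (ξ j (x 0))) (M j) (a j) (E4.ofTimeSpace (x 0) (ξ i (x 0))) - Minkowski.bilin)))) + (ContinuousLinearMap.precomp ℝ ((2⁻¹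 : ℝ) • ((Minkowski.bilin : E4 →L[ℝ] E4 →L[ℝ] ℝ).inverse.comp (∑ j ∈ Finset.univ.erase i, (boostedKerrBilin (Λ j (x 0)) (E4.ofTimeSpace (x 0) (ξ j (x 0))) (M j) (a j) (E4.ofTimeSpace (x 0) (ξ i (x 0))) - Minkowski.bilin))))).comp (boostedKerrBilin (Λ i (x 0)) (E4.ofTimeSpace (x 0) (ξ i (x 0))) (M i) (a i) x - Minkowski.bilin)) (fun i x ↦ rin i < Kerr.radius (a i) (poincareInv (Λ i (x 0)) (E4.ofTimeSpace (x 0) (ξ i (x 0))) x)) ξ κ τ₀ T U hmem hg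
      (fun i ↦ (hlim i).2)

end Summit.FinalStateConjecture.FinalStateConjecture.Cruxes.ModulatedKerrHandoff.OverlapModulationSecondIterate

namespace Summit.FinalStateConjecture.FinalStateConjecture.Theorems

/-- Registered sub-goal form (stub `drag_tendsto_const_div` of the crux item) of
`Drag.tendsto_const_div`: `K / t → 0` as `t → ∞`. [folklore] -/
theorem drag_tendsto_const_div : ∀ (K : ℝ), Filter.Tendsto (fun t : ℝ ↦ K / t) Filter.atTop (nhds 0) :=
  fun K ↦ Drag.tendsto_const_div K

end Summit.FinalStateConjecture.FinalStateConjecture.Theorems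

end
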